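import Mathlib
import HarnessLib
import Literature.MathematicalPhysics.QuantumLattice.GaugeGroups
import Literature.MathematicalPhysics.QuantumFieldTheory.ConstructiveQFTWave0
import Literature.MathematicalPhysics.QuantumFieldTheory.LatticeGaugeProofs
import Summits.Ventures.LatticeQCDFlow.Scaling.FluxTunnellingU1AllVolumes
import Summits.Ventures.LatticeQCDFlow.Scaling.FluxTunnellingU1Autocorrelation

/-!
# LatticeQCDFlow / Scaling — the explicit sector-autocorrelation floor of 2-d `U(1)` at EVERY volume

HONEST FRAMING: exact (Metropolis-corrected) sampling algorithms for lattice gauge theory; figures of merit are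
autocorrelation/cost numbers at stated couplings and volumes; no continuum-physics claim.

Venture `LatticeQCDFlow` (cell pub-lqcd), topic `Scaling`, FANOUT row 30 (lean-1) — OUR WORK, file 8 of the explicit
`U(1)` tunnelling programme: the odd-volume companion of `Scaling/FluxTunnellingU1Autocorrelation.lean`, with the
all-volume constant `c(β) = e^{−3/2}/(π·max(1,β))` of `Scaling/FluxTunnellingU1AllVolumes.lean`.  For the 2-d Wilson
measure `μ_{β,L}` of `U(1)`, EVERY `L ≥ 2`, `β ≥ 0`:

* `u1_mul_pow_three_mul_measure_linkPatch_le` — `c(β)·z₁(β)³·μ_{β,L}{S_P ≥ 2} ≤ e^{−2β}` for the plane positions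
  touched by one link; `u1_measureReal_linkPatch_le_all` — the same as `μ_{β,L}{S_P ≥ 2} ≤ e^{−2β}/(c(β) z₁(β)³)`;
* **`u1_tunnelling_sweep_nsteps_all`** — `c(β)·z₁³·P{Q(Z_n) ≠ Q(Z_0)} ≤ n·2e^{−2β}` for any process with one-time
  marginals `μ_{β,L}` and one-link steps;
* **`u1_sector_autocov_floor_all`** — `Cov(1_S(Q(Z_0)), 1_S(Q(Z_n))) ≥ a(1 − a) − n·2e^{−2β}/(c(β) z₁(β)³)`.

Elementary given files 5–7; nothing is cited as a fact; no `def`.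
-/

noncomputable section

namespace Summit.Ventures.LatticeQCDFlow.Theory2.Lattice.TwoDim

open MeasureTheory ProbabilityTheory Literature.MathematicalPhysics.QuantumFieldTheory
open Literature.MathematicalPhysics.QuantumLattice (u1Rep u1Rep_apply continuous_u1Rep)
open Summit.Ventures.LatticeQCDFlow.Theory2.Lattice.Flux
open scoped ENNReal

variable {L : ℕ}

/-- **PER-LINK THICK-PLAQUETTE TAIL AT EVERY VOLUME**: `c(β)·z₁(β)³·μ_{β,L}{S_P ≥ #P(1 − cos(π/#P))} ≤ e^{−2β}` for the
plane positions `P` touched by the link `e₀` (`L ≥ 2`, `β ≥ 0`). [folklore] -/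
theorem u1_mul_pow_three_mul_measure_linkPatch_le [NeZero L] (hL : 2 ≤ L) {β : ℝ} (hβ : 0 ≤ β)
    (x₀ : Site 2 L) (e₀ : Edge 2 L) :
    ENNReal.ofReal (Real.exp (-(3 / 2)) * (1 / Real.pi * (max 1 β)⁻¹)) * z1 u1Rep β ^ 3 *
        wilsonMeasure (d := 2) (L := L) u1Rep β
          {U | ((Finset.univ.filter fun p : ZMod L × ZMod L => e₀ ∈ plaqLinks (planeSite x₀ 0 1 p) 0 1).card : ℝ) *
              (1 - Real.cos (Real.pi /
                (Finset.univ.filter fun p : ZMod L × ZMod L => e₀ ∈ plaqLinks (planeSite x₀ 0 1 p) 0 1).card)) ≤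
            patchAction x₀ 0 1
              (Finset.univ.filter fun p : ZMod L × ZMod L => e₀ ∈ plaqLinks (planeSite x₀ 0 1 p) 0 1) U} ≤
      ENNReal.ofReal (Real.exp (-(2 * β))) := by
  classical
  set c : ℝ≥0∞ := ENNReal.ofReal (Real.exp (-(3 / 2)) * (1 / Real.pi * (max 1 β)⁻¹)) with hc
  set P' : Finset (ZMod L × ZMod L) :=
    Finset.univ.filter fun p => e₀ ∈ plaqLinks (planeSite x₀ 0 1 p) 0 1 with hP'
  have hPne : P'.Nonempty := by
    refine ⟨((e₀.1 - x₀) 0, (e₀.1 - x₀) 1), Finset.mem_filter.mpr ⟨Finset.mem_univ _, ?_⟩⟩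
    rw [(planeSite_eq_iff x₀ e₀.1 _).mpr rfl]
    obtain ⟨y, i⟩ := e₀
    fin_cases i <;> simp [plaqLinks]
  have hcard : P'.card ≤ 2 := card_touched_le_two x₀ e₀
  have hthr : (P'.card : ℝ) * (1 - Real.cos (Real.pi / P'.card)) = 2 := by
    have h1 : 1 ≤ P'.card := hPne.card_pos
    interval_cases h : P'.card
    · simp [Real.cos_pi]; norm_num
    · simp [Real.cos_pi_div_two]
  set P : Finset (Site 2 L) := P'.image (planeSite x₀ 0 1) with hPdef
  have hinj : Set.InjOn (planeSite x₀ 0 1) (P' : Set (ZMod L × ZMod L)) := by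
    intro p _ q _ hpq
    rw [(planeSite_eq_iff x₀ _ p).mp hpq, ← (planeSite_eq_iff x₀ _ q).mp rfl]
  have hPcard : P.card ≤ 2 * 1 := by rw [hPdef, Finset.card_image_of_injOn hinj]; omega
  have hset : {U : GaugeConfig 2 L Circle | (P'.card : ℝ) * (1 - Real.cos (Real.pi / P'.card)) ≤
      patchAction x₀ 0 1 P' U} =
      {U | (2 : ℝ) ≤ ∑ x ∈ P, (1 - ((plaquetteHolonomy U x 0 1 : Circle) : ℂ).re)} := by
    ext U
    simp only [Set.mem_setOf_eq, hthr, patchAction, hPdef, Finset.sum_image hinj]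
  have hn : 2 * 1 + 2 ≤ L ^ 2 := by nlinarith
  have htail := u1_mul_pow_mul_measure_actionSum_ge_le hL hβ P 1 hPcard hn 2
  have hz1 : z1 u1Rep β ≤ 1 := z1_le_one u1Rep U1.re_trace_u1Rep_le hβ
  rw [hset]
  calc c * z1 u1Rep β ^ 3 * wilsonMeasure (d := 2) (L := L) u1Rep β
          {U | (2 : ℝ) ≤ ∑ x ∈ P, (1 - ((plaquetteHolonomy U x 0 1 : Circle) : ℂ).re)}
      ≤ c * z1 u1Rep β ^ (1 + P.card) * wilsonMeasure (d := 2) (L := L) u1Rep β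
          {U | (2 : ℝ) ≤ ∑ x ∈ P, (1 - ((plaquetteHolonomy U x 0 1 : Circle) : ℂ).re)} :=
        mul_le_mul' (mul_le_mul' le_rfl (pow_le_pow_right_of_le_one' hz1 (by omega))) le_rfl
    _ ≤ ENNReal.ofReal (Real.exp (-(β * 2))) := htail
    _ = ENNReal.ofReal (Real.exp (-(2 * β))) := by rw [mul_comm β 2]

/-- The same tail as a real number: `μ_{β,L}{S_P ≥ 2} ≤ e^{−2β}/(c(β)·z₁(β)³)`, written with
`c(β)·z₁(β)³ = (e^{−3/2}/(π max(1,β)))·z₁(β).toReal³`. [folklore] -/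
theorem u1_measureReal_linkPatch_le_all [NeZero L] (hL : 2 ≤ L) {β : ℝ} (hβ : 0 ≤ β)
    (x₀ : Site 2 L) (e₀ : Edge 2 L) :
    (wilsonMeasure (d := 2) (L := L) u1Rep β).real
        {U | ((Finset.univ.filter fun p : ZMod L × ZMod L => e₀ ∈ plaqLinks (planeSite x₀ 0 1 p) 0 1).card : ℝ) *
            (1 - Real.cos (Real.pi /
              (Finset.univ.filter fun p : ZMod L × ZMod L => e₀ ∈ plaqLinks (planeSite x₀ 0 1 p) 0 1).card)) ≤
          patchAction x₀ 0 1
            (Finset.univ.filter fun p : ZMod L × ZMod L => e₀ ∈ plaqLinks (planeSite x₀ 0 1 p) 0 1) U} ≤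
      Real.exp (-(2 * β)) /
        (Real.exp (-(3 / 2)) * (1 / Real.pi * (max 1 β)⁻¹) * (z1 u1Rep β).toReal ^ 3) := by
  classical
  set T : Set (GaugeConfig 2 L Circle) :=
    {U | ((Finset.univ.filter fun p : ZMod L × ZMod L => e₀ ∈ plaqLinks (planeSite x₀ 0 1 p) 0 1).card : ℝ) *
        (1 - Real.cos (Real.pi /
          (Finset.univ.filter fun p : ZMod L × ZMod L => e₀ ∈ plaqLinks (planeSite x₀ 0 1 p) 0 1).card)) ≤
      patchAction x₀ 0 1
        (Finset.univ.filter fun p : ZMod L × ZMod L => e₀ ∈ plaqLinks (planeSite x₀ 0 1 p) 0 1) U} with hT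
  have h : ENNReal.ofReal (Real.exp (-(3 / 2)) * (1 / Real.pi * (max 1 β)⁻¹)) * z1 u1Rep β ^ 3 *
      wilsonMeasure (d := 2) (L := L) u1Rep β T ≤ ENNReal.ofReal (Real.exp (-(2 * β))) :=
    u1_mul_pow_three_mul_measure_linkPatch_le hL hβ x₀ e₀
  have hz := z1_toReal_pos hβ
  have hzt : z1 u1Rep β ≠ ⊤ :=
    ne_top_of_le_ne_top ENNReal.one_ne_top (z1_le_one u1Rep U1.re_trace_u1Rep_le hβ)
  have hc0 : 0 < Real.exp (-(3 / 2)) * (1 / Real.pi * (max 1 β)⁻¹) := by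
    have : 0 < max 1 β := lt_of_lt_of_le one_pos (le_max_left _ _)
    positivity
  haveI : IsProbabilityMeasure (wilsonMeasure (d := 2) (L := L) u1Rep β) :=
    isProbabilityMeasure_wilsonMeasure u1Rep continuous_u1Rep β
  rw [le_div_iff₀ (mul_pos hc0 (pow_pos hz 3)), mul_comm, measureReal_def, ← ENNReal.toReal_pow,
    ← ENNReal.toReal_ofReal hc0.le, ← ENNReal.toReal_mul, ← ENNReal.toReal_mul]
  have hne : ENNReal.ofReal (Real.exp (-(3 / 2)) * (1 / Real.pi * (max 1 β)⁻¹)) * z1 u1Rep β ^ 3 *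
      wilsonMeasure (d := 2) (L := L) u1Rep β T ≠ ⊤ :=
    ENNReal.mul_ne_top (ENNReal.mul_ne_top ENNReal.ofReal_ne_top (ENNReal.pow_ne_top hzt)) (measure_ne_top _ _)
  calc (ENNReal.ofReal (Real.exp (-(3 / 2)) * (1 / Real.pi * (max 1 β)⁻¹)) * z1 u1Rep β ^ 3 *
        wilsonMeasure (d := 2) (L := L) u1Rep β T).toReal
      ≤ (ENNReal.ofReal (Real.exp (-(2 * β)))).toReal := (ENNReal.toReal_le_toReal hne ENNReal.ofReal_ne_top).mpr h
    _ = Real.exp (-(2 * β)) := ENNReal.toReal_ofReal (Real.exp_pos _).le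

/-- **THE EXPLICIT SWEEP LAW AT EVERY VOLUME**: `c(β)·z₁(β)³·P{Q(Z_n) ≠ Q(Z_0)} ≤ n·2·e^{−2β}` for any process with
one-time marginals `μ_{β,L}` whose steps change one link each (`L ≥ 2`, `β ≥ 0`). [folklore] -/
theorem u1_tunnelling_sweep_nsteps_all [NeZero L] (hL : 2 ≤ L) {β : ℝ} (hβ : 0 ≤ β)
    (x₀ : Site 2 L) {Ω : Type*} [MeasurableSpace Ω] (P : Measure Ω) [IsProbabilityMeasure P]
    (Z : ℕ → Ω → GaugeConfig 2 L Circle) (hZ : ∀ k, Measurable (Z k))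
    (hmarg : ∀ k, P.map (Z k) = wilsonMeasure (d := 2) (L := L) u1Rep β)
    (e : ℕ → Edge 2 L) (hloc : ∀ k, ∀ᵐ ω ∂P, ∀ e', e' ≠ e k → Z k ω e' = Z (k + 1) ω e') (n : ℕ) :
    Real.exp (-(3 / 2)) * (1 / Real.pi * (max 1 β)⁻¹) * (z1 u1Rep β).toReal ^ 3 *
        P.real {ω | Flux.topCharge x₀ 0 1 (Z n ω) ≠ Flux.topCharge x₀ 0 1 (Z 0 ω)} ≤
      n * (2 * Real.exp (-(2 * β))) := by
  classical
  set μW := wilsonMeasure (d := 2) (L := L) u1Rep β with hμW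
  haveI : IsProbabilityMeasure μW := isProbabilityMeasure_wilsonMeasure u1Rep continuous_u1Rep β
  set K : ℝ := Real.exp (-(3 / 2)) * (1 / Real.pi * (max 1 β)⁻¹) * (z1 u1Rep β).toReal ^ 3 with hK
  have hK0 : 0 < K := by
    have : 0 < max 1 β := lt_of_lt_of_le one_pos (le_max_left _ _)
    have := z1_toReal_pos hβ
    positivity
  let Pk : ℕ → Finset (ZMod L × ZMod L) := fun k =>
    Finset.univ.filter fun p => e k ∈ plaqLinks (planeSite x₀ 0 1 p) 0 1
  let B : ℕ → Set (GaugeConfig 2 L Circle) := fun k =>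
    {U | ((Pk k).card : ℝ) * (1 - Real.cos (Real.pi / (Pk k).card)) ≤ patchAction x₀ 0 1 (Pk k) U}
  have hPne : ∀ k, (Pk k).Nonempty := by
    intro k
    refine ⟨(((e k).1 - x₀) 0, ((e k).1 - x₀) 1), Finset.mem_filter.mpr ⟨Finset.mem_univ _, ?_⟩⟩
    rw [(planeSite_eq_iff x₀ (e k).1 _).mpr rfl]
    obtain ⟨y, i⟩ := e k
    fin_cases i <;> simp [plaqLinks]
  have hP : ∀ k p, (∃ e' ∈ plaqLinks (planeSite x₀ 0 1 p) 0 1, e' ∈ ({e k} : Finset (Edge 2 L))) → p ∈ Pk k := by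
    rintro k p ⟨e', he', he0⟩
    rw [Finset.mem_singleton] at he0
    subst he0
    exact Finset.mem_filter.mpr ⟨Finset.mem_univ _, he'⟩
  have hB : ∀ k ⦃U U' : GaugeConfig 2 L Circle⦄, (∀ e', e' ≠ e k → U e' = U' e') →
      Flux.topCharge x₀ 0 1 U ≠ Flux.topCharge x₀ 0 1 U' → U ∈ B k ∨ U' ∈ B k := by
    intro k U U' hUU' hQ
    have hoff := plaquette_eq_off_patch_of_links (hP k) (U := U) (U' := U')
      (fun e' he' => hUU' e' (fun h => he' (Finset.mem_singleton.mpr h)))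
    exact patchAction_ge_sharp_or_of_topCharge_ne x₀ 0 1 (hPne k) hoff hQ
  have hpos : 0 ≤ 2 * (Real.exp (-(2 * β)) / K) := by positivity
  have hm : ∀ k, P.real (Z k ⁻¹' B k) + P.real (Z (k + 1) ⁻¹' B k) ≤ 2 * (Real.exp (-(2 * β)) / K) := by
    intro k
    have hle : ∀ j, P.real (Z j ⁻¹' B k) ≤ Real.exp (-(2 * β)) / K := by
      intro j
      refine le_trans ?_ (u1_measureReal_linkPatch_le_all hL hβ x₀ (e k))
      rw [measureReal_def, measureReal_def, ← hμW, ← hmarg j]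
      exact ENNReal.toReal_mono (measure_ne_top _ _) (Measure.le_map_apply (hZ j).aemeasurable _)
    have := hle k; have := hle (k + 1); linarith
  have h := Tunnelling.measureReal_chargeChange_le_nsteps (R := fun k (U U' : GaugeConfig 2 L Circle) =>
    ∀ e', e' ≠ e k → U e' = U' e') (Q := Flux.topCharge x₀ 0 1) (B := B) hB P Z hloc hpos hm n
  calc K * P.real {ω | Flux.topCharge x₀ 0 1 (Z n ω) ≠ Flux.topCharge x₀ 0 1 (Z 0 ω)}
      ≤ K * (n * (2 * (Real.exp (-(2 * β)) / K))) := mul_le_mul_of_nonneg_left h hK0.le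
    _ = n * (2 * Real.exp (-(2 * β))) := by field_simp

/-- **THE EXPLICIT SECTOR-AUTOCORRELATION FLOOR AT EVERY VOLUME**: with `a := P{Q(Z_0) ∈ S} = P{Q(Z_n) ∈ S}`,
`a(1 − a) − n·2e^{−2β}/(c(β)·z₁(β)³) ≤ Cov(1_S(Q(Z_0)), 1_S(Q(Z_n)))` (`L ≥ 2`, `β ≥ 0`). [folklore] -/
theorem u1_sector_autocov_floor_all [NeZero L] (hL : 2 ≤ L) {β : ℝ} (hβ : 0 ≤ β)
    (x₀ : Site 2 L) {Ω : Type*} [MeasurableSpace Ω] (P : Measure Ω) [IsProbabilityMeasure P]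
    (Z : ℕ → Ω → GaugeConfig 2 L Circle) (hZ : ∀ k, Measurable (Z k))
    (hmarg : ∀ k, P.map (Z k) = wilsonMeasure (d := 2) (L := L) u1Rep β)
    (e : ℕ → Edge 2 L) (hloc : ∀ k, ∀ᵐ ω ∂P, ∀ e', e' ≠ e k → Z k ω e' = Z (k + 1) ω e')
    (S : Set ℝ) (n : ℕ) {a : ℝ} (h0 : P.real {ω | Flux.topCharge x₀ 0 1 (Z 0 ω) ∈ S} = a)
    (hn : P.real {ω | Flux.topCharge x₀ 0 1 (Z n ω) ∈ S} = a) :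
    a * (1 - a) - n * (2 * (Real.exp (-(2 * β)) /
        (Real.exp (-(3 / 2)) * (1 / Real.pi * (max 1 β)⁻¹) * (z1 u1Rep β).toReal ^ 3))) ≤
      P.real {ω | Flux.topCharge x₀ 0 1 (Z 0 ω) ∈ S ∧ Flux.topCharge x₀ 0 1 (Z n ω) ∈ S} -
        P.real {ω | Flux.topCharge x₀ 0 1 (Z 0 ω) ∈ S} * P.real {ω | Flux.topCharge x₀ 0 1 (Z n ω) ∈ S} := by
  classical
  set μW := wilsonMeasure (d := 2) (L := L) u1Rep β with hμW
  haveI : IsProbabilityMeasure μW := isProbabilityMeasure_wilsonMeasure u1Rep continuous_u1Rep β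
  set K : ℝ := Real.exp (-(3 / 2)) * (1 / Real.pi * (max 1 β)⁻¹) * (z1 u1Rep β).toReal ^ 3 with hK
  have hK0 : 0 < K := by
    have : 0 < max 1 β := lt_of_lt_of_le one_pos (le_max_left _ _)
    have := z1_toReal_pos hβ
    positivity
  let Pk : ℕ → Finset (ZMod L × ZMod L) := fun k =>
    Finset.univ.filter fun p => e k ∈ plaqLinks (planeSite x₀ 0 1 p) 0 1
  let B : ℕ → Set (GaugeConfig 2 L Circle) := fun k =>
    {U | ((Pk k).card : ℝ) * (1 - Real.cos (Real.pi / (Pk k).card)) ≤ patchAction x₀ 0 1 (Pk k) U}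
  have hPne : ∀ k, (Pk k).Nonempty := by
    intro k
    refine ⟨(((e k).1 - x₀) 0, ((e k).1 - x₀) 1), Finset.mem_filter.mpr ⟨Finset.mem_univ _, ?_⟩⟩
    rw [(planeSite_eq_iff x₀ (e k).1 _).mpr rfl]
    obtain ⟨y, i⟩ := e k
    fin_cases i <;> simp [plaqLinks]
  have hP : ∀ k p, (∃ e' ∈ plaqLinks (planeSite x₀ 0 1 p) 0 1, e' ∈ ({e k} : Finset (Edge 2 L))) → p ∈ Pk k := by
    rintro k p ⟨e', he', he0⟩
    rw [Finset.mem_singleton] at he0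
    subst he0
    exact Finset.mem_filter.mpr ⟨Finset.mem_univ _, he'⟩
  have hB : ∀ k ⦃U U' : GaugeConfig 2 L Circle⦄, (∀ e', e' ≠ e k → U e' = U' e') →
      Flux.topCharge x₀ 0 1 U ≠ Flux.topCharge x₀ 0 1 U' → U ∈ B k ∨ U' ∈ B k := by
    intro k U U' hUU' hQ
    have hoff := plaquette_eq_off_patch_of_links (hP k) (U := U) (U' := U')
      (fun e' he' => hUU' e' (fun h => he' (Finset.mem_singleton.mpr h)))
    exact patchAction_ge_sharp_or_of_topCharge_ne x₀ 0 1 (hPne k) hoff hQ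
  have hpos : 0 ≤ 2 * (Real.exp (-(2 * β)) / K) := by positivity
  have hm : ∀ k, P.real (Z k ⁻¹' B k) + P.real (Z (k + 1) ⁻¹' B k) ≤ 2 * (Real.exp (-(2 * β)) / K) := by
    intro k
    have hle : ∀ j, P.real (Z j ⁻¹' B k) ≤ Real.exp (-(2 * β)) / K := by
      intro j
      refine le_trans ?_ (u1_measureReal_linkPatch_le_all hL hβ x₀ (e k))
      rw [measureReal_def, measureReal_def, ← hμW, ← hmarg j]
      exact ENNReal.toReal_mono (measure_ne_top _ _) (Measure.le_map_apply (hZ j).aemeasurable _)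
    have := hle k; have := hle (k + 1); linarith
  exact Tunnelling.sectorAutocov_ge (R := fun k (U U' : GaugeConfig 2 L Circle) => ∀ e', e' ≠ e k → U e' = U' e')
    (Q := Flux.topCharge x₀ 0 1) (B := B) hB P Z hloc hpos hm S n h0 hn

end Summit.Ventures.LatticeQCDFlow.Theory2.Lattice.TwoDim
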